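import Summits.ResolutionOfSingularities.ResolutionOfSingularities.Theorems.PurelyInseparableDim4MohAlong
import Summits.ResolutionOfSingularities.ResolutionOfSingularities.Theorems.PurelyInseparableDim4Target
import Literature.AlgebraicGeometry.Resolution.OrdZeroBasics
import HarnessLib

/-!
# Purely inseparable four-folds — Moh's `+1` at points ALONG a coordinate centre (PR-1 (ii), (iii)⁺)

[OURS · counted 0 · cell `res-dim4-pi`, D-0157 DOOR 2, brick PR-1; AI work, weaker than expert review]
Nothing in this file is a statement about resolution of singularities (dimension `≥ 4`,
characteristic `p`: NOT proved anywhere in this programme); census/instrument value only.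

Sequel of `PurelyInseparableDim4MohAlong.lean` (`step_add_eq_step_translate_clean`: the blow-up step
at the point `b' + c` of the `y_j`-chart is the step at the fibre point `b'` of the state MOVED to the
point `c` of the centre and re-cleaned, `s@c := ⟨deletePthPowers p (translate c F), r|_{c=0}, exc|_{c=0}⟩`
— written out as a structure literal throughout). Here, at the order of record `q = p`:

* §1 what the move transports from the origin to `c`: cleanness, `F ≠ 0`, `y^{r'} ∣ F` with
  `r' = r|_{c=0}`, Hironaka-permissibility (1) `p ≤ ord_{C_S}`, and Moh's condition (3) / HP's (2)
  RELATIVE TO THE ORIGIN'S SHADE `d` (`degIn S r' + d ≤ degIn S e` on the support); hence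
  `shade_le_shade_translate` — **along an HP-permissible centre the shade at every point `c` is
  `≥` the shade `d` at the origin** (the origin MINIMISES the shade along the centre; (iii)⁺).
* §2 `shade_step_le_shade_translate_add_one` — **Moh's `+1` at a translated point, relative to the
  shade AT `c`**: if `C_S` is Moh-permissible for the moved state `s@c` (condition (2) at `c`), then
  `shade(step p S j (b' + c) s) ≤ shade(s@c) + 1` (the tree's `CentreBlowup.mohBound_one` at `c`);
  `shade_step_le_shade_add_one_of_shade_translate_eq` — if (2) holds at the ORIGIN and the shade
  does not jump at `c` (`shade(s@c) = shade(s)`), then (2) holds at `c` and the bound is relative to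
  `shade(s)` itself. The no-jump clause is NOT automatic: (2) at the origin forces `shade(s@c) ≥
  shade(s)` only, and `>` happens at special points of the centre (kernel example in
  `PurelyInseparableDim4MohAlongSpecialPoint.lean`: «shade constant along a MODE-1h centre with
  perm2 = 1» is false as worded).
* §3 the same for the cell's frame (`PIDim4.State`, `IsPermissibleCentre`, `Perm2`, `Edge`):
  `shade_le_add_one_of_edge` — on every `Edge p S s s'` along a centre with (1) ∧ (2) at `s` on which
  the shade is constant at the `K`-points, `s'.shade ≤ s.shade + 1`; and the referee form for an
  arbitrary chart point `b` via `S.piecewise`.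

bears_on: LADDER-RESOLUTION:D157-DOOR2 (res-dim4-pi · PR-1). Supports
stmt-ResolutionOfSingularities-16155 (helper).
-/

set_option linter.dupNamespace false

noncomputable section

open MvPolynomial Finset

open scoped BigOperators

namespace Summit.ResolutionOfSingularities.ResolutionOfSingularities.Theorems.PIDim4

open Literature.AlgebraicGeometry.Resolution
open Literature.AlgebraicGeometry.Resolution.Hauser2010
open Literature.AlgebraicGeometry.Resolution.CentreBlowup
open Literature.Barriers.ResolutionOfSingularities

namespace MohAlong

/-! ## 1. What the move along the centre transports -/

section Transport

variable {σ : Type*} {K : Type*} [Field K] [Fintype σ] [DecidableEq σ] [DecidableEq K]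

omit [DecidableEq K] in
/-- A monomial of the moved-and-re-cleaned polynomial lies below a monomial of `F` and agrees with it
at every untranslated variable. [folklore] -/
theorem exists_of_mem_support_clean_translate (q : ℕ) (c : σ → K) (F : MvPolynomial σ K)
    {e : σ →₀ ℕ} (he : e ∈ (deletePthPowers q (PointBlowup.translate c F)).support) :
    ∃ d ∈ F.support, e ≤ d ∧ ∀ i, c i = 0 → e i = d i :=
  exists_of_mem_support_translate c F (mem_support_of_mem_support_deletePthPowers q he).1

omit [DecidableEq K] in
/-- **A clean non-zero `F` stays non-zero** after the move and the re-cleaning. [folklore] -/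
theorem clean_translate_ne_zero (q : ℕ) (c : σ → K) {F : MvPolynomial σ K}
    (hclean : deletePthPowers q F = F) (hF : F ≠ 0) :
    deletePthPowers q (PointBlowup.translate c F) ≠ 0 := by
  obtain ⟨d₀, hd₀, -, hcoeff⟩ :=
    exists_ordAlong_eq_coeff_translate_eq (S := (∅ : Finset σ)) c (by simp) hF
  intro h
  have := congrArg (coeff d₀) h
  rw [coeff_deletePthPowers, if_neg (PointBlowup.not_isPthPowerExponent_of_clean q hclean hd₀), hcoeff,
    coeff_zero] at this
  exact (MvPolynomial.mem_support_iff.mp hd₀) this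

/-- **The exceptional monomial through `c` divides the moved polynomial**: `y^{r|_{c=0}} ∣` every
monomial of `deletePthPowers q (translate c F)` if `y^r ∣` every monomial of `F`. [folklore] -/
theorem filter_le_of_mem_support_clean_translate (q : ℕ) (c : σ → K) {F : MvPolynomial σ K}
    {r : σ →₀ ℕ} (hr : ∀ d ∈ F.support, r ≤ d) {e : σ →₀ ℕ}
    (he : e ∈ (deletePthPowers q (PointBlowup.translate c F)).support) :
    r.filter (fun i => c i = 0) ≤ e := by
  obtain ⟨d, hd, -, hS⟩ := exists_of_mem_support_clean_translate q c F he
  refine Finsupp.le_def.mpr fun i => ?_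
  rw [Finsupp.filter_apply]
  split_ifs with hi
  · rw [hS i hi]; exact Finsupp.le_def.mp (hr d hd) i
  · exact Nat.zero_le _

omit [DecidableEq K] in
/-- The `S`-degree of a monomial of the moved polynomial is that of a monomial of `F` (`c` supported
off `S`); in particular **Hironaka-permissibility (1) transports along the centre**. [folklore] -/
theorem le_degIn_of_mem_support_clean_translate (q : ℕ) {S : Finset σ} (c : σ → K)
    (hc : ∀ i ∈ S, c i = 0) {F : MvPolynomial σ K} {m : ℕ} (hq : ∀ d ∈ F.support, m ≤ degIn S d)
    {e : σ →₀ ℕ} (he : e ∈ (deletePthPowers q (PointBlowup.translate c F)).support) :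
    m ≤ degIn S e := by
  obtain ⟨d, hd, -, hS⟩ := exists_of_mem_support_clean_translate q c F he
  rw [degIn_eq_of_forall (fun i hi => hS i (hc i hi))]
  exact hq d hd

omit [Fintype σ] [DecidableEq σ] in
/-- Losing the components not through `c` does not change the `S`-degree of `r` (`c` vanishes on `S`).
[folklore] -/
theorem degIn_filter_eq {S : Finset σ} (c : σ → K) (hc : ∀ i ∈ S, c i = 0) (r : σ →₀ ℕ) :
    degIn S (r.filter (fun i => c i = 0)) = degIn S r :=
  Finset.sum_congr rfl fun i hi => by rw [Finsupp.filter_apply, if_pos (hc i hi)]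

/-- **Moh's condition (3) / HP's (2) transports RELATIVE TO THE ORIGIN'S SHADE `d`**: if every
monomial of `F` has `degIn S ≥ degIn S r + d`, so does every monomial of the moved polynomial, with
`r|_{c=0}` in place of `r`. [folklore] -/
theorem perm_of_mem_support_clean_translate (q : ℕ) {S : Finset σ} (c : σ → K)
    (hc : ∀ i ∈ S, c i = 0) {F : MvPolynomial σ K} {r : σ →₀ ℕ} {d₀ : ℕ}
    (hperm : ∀ d ∈ F.support, degIn S r + d₀ ≤ degIn S d) {e : σ →₀ ℕ}
    (he : e ∈ (deletePthPowers q (PointBlowup.translate c F)).support) :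
    degIn S (r.filter (fun i => c i = 0)) + d₀ ≤ degIn S e := by
  rw [degIn_filter_eq c hc r]
  exact le_degIn_of_mem_support_clean_translate q c hc hperm he

/-- **Along an HP-permissible centre the order of the moved residual polynomial is at least
`|r|_{c=0}| + d`**, `d` the shade at the origin. [folklore] -/
theorem le_ordZero_clean_translate (q : ℕ) {S : Finset σ} (c : σ → K) (hc : ∀ i ∈ S, c i = 0)
    {F : MvPolynomial σ K} {r : σ →₀ ℕ} (hr : ∀ d ∈ F.support, r ≤ d) {d₀ : ℕ}
    (hperm : ∀ d ∈ F.support, degIn S r + d₀ ≤ degIn S d) :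
    (((r.filter (fun i => c i = 0)).degree + d₀ : ℕ) : ℕ∞) ≤
      ordZero (deletePthPowers q (PointBlowup.translate c F)) := by
  refine le_ordZero_of_forall _ _ fun e he => ?_
  have he' : e ∈ (deletePthPowers q (PointBlowup.translate c F)).support :=
    MvPolynomial.mem_support_iff.mpr he
  have h1 := perm_of_mem_support_clean_translate q c hc hperm he'
  have h2 := filter_le_of_mem_support_clean_translate q c hr he'
  have h3 := degIn_add_sum_compl S e
  have h4 := degIn_add_sum_compl S (r.filter (fun i => c i = 0))
  have h5 : ∑ i ∈ Sᶜ, (r.filter (fun i => c i = 0)) i ≤ ∑ i ∈ Sᶜ, e i :=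
    Finset.sum_le_sum fun i _ => Finsupp.le_def.mp h2 i
  omega

omit [Field K] [Fintype σ] [DecidableEq σ] [DecidableEq K] in
/-- `ℕ∞` bookkeeping: `m + k ≤ a` gives `k ≤ a − m`. [folklore] -/
theorem enat_coe_le_sub_of_add_le {a : ℕ∞} {m k : ℕ} (h : ((m + k : ℕ) : ℕ∞) ≤ a) :
    (k : ℕ∞) ≤ a - m := by
  induction a using ENat.recTopCoe with
  | top => rw [ENat.top_sub_coe]; exact le_top
  | coe n =>
    have h' : m + k ≤ n := by exact_mod_cast h
    rw [← ENat.coe_sub]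
    exact_mod_cast (by omega : k ≤ n - m)

/-- **(iii)⁺ The origin minimises the shade along an HP-permissible centre.** If `C_S` satisfies
Moh's (3) / HP's (2) for the state `s` at the origin (`degIn S r + shade(s) ≤ degIn S d` on the
support, i.e. the cell's `Perm2`), then at EVERY point `c` of the centre the moved-and-re-cleaned state
has shade `≥ shade(s)`. Equality holds off a proper closed subset of `C_S` and FAILS at its special
points (see `PurelyInseparableDim4MohAlongSpecialPoint.lean`). [folklore] -/
theorem shade_le_shade_translate (q : ℕ) {S : Finset σ} (c : σ → K) (hc : ∀ i ∈ S, c i = 0)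
    (s : CState σ K) {o : ℕ} (ho : ordZero s.F = o) (hr : ∀ d ∈ s.F.support, s.r ≤ d)
    (hperm : ∀ d ∈ s.F.support, degIn S s.r + (o - s.r.degree) ≤ degIn S d) :
    s.shade ≤ CState.shade ⟨deletePthPowers q (PointBlowup.translate c s.F),
      s.r.filter (fun i => c i = 0), s.exc.filter (fun i => c i = 0)⟩ := by
  rw [CState.shade_eq_of_ordZero_eq s ho]
  unfold CState.shade
  exact enat_coe_le_sub_of_add_le (le_ordZero_clean_translate q c hc hr hperm)

end Transport

/-! ## 2. Moh's `+1` at translated points -/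

section Bound

variable {σ : Type*} {K : Type*} [Field K] [Fintype σ] [DecidableEq σ] [DecidableEq K]
variable (p : ℕ) [hp : Fact p.Prime] [CharP K p]

/-- `step_add_eq_step_translate_clean` at the order of record `q = p`. [folklore] -/
theorem step_add_eq_step_translate_clean_one {S : Finset σ} {j : σ} (hj : j ∈ S) (b' c : σ → K)
    (hb' : ∀ i, i ∉ S → b' i = 0) (hc : ∀ i ∈ S, c i = 0) (s : CState σ K)
    (hclean : deletePthPowers p s.F = s.F) :
    step p S j (b' + c) s =
      step p S j b' ⟨deletePthPowers p (PointBlowup.translate c s.F),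
        s.r.filter (fun i => c i = 0), s.exc.filter (fun i => c i = 0)⟩ := by
  have h := step_add_eq_step_translate_clean (K := K) p 1 hj b' c hb' hc s (by rwa [pow_one])
  rw [pow_one] at h
  exact h

/-- **Moh's bound `+1` at a translated point, relative to the shade AT `c`.** Let `s = (F, r, exc)`
be a clean state (`F ≠ 0`, `y^r ∣ F`), `S ∋ j` with `C_S` in the `p`-fold locus (`p ≤ degIn S d` on the
support), `b'` a fibre coordinate (`b'_j = 0`, `b' = 0` off `S`) and `c` a point of the centre (`c = 0`
on `S`). If `C_S` is Moh-permissible for the MOVED state `s@c` — HP's condition (2) AT `c`,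
`degIn S r' + shade(s@c) ≤ ord_{C_S}` — then the shade after the blow-up of `C_S` read at the point
`b' + c` is at most `shade(s@c) + 1`: the tree's `CentreBlowup.mohBound_one` applied at `c`, through
`step_add_eq_step_translate_clean`. [cite: Moh1987, Stability Theorem (one permissible blow-up), §1]
[cite: HauserPerlega2019PRIMS, §3 Theorem (9)] -/
theorem shade_step_le_shade_translate_add_one {S : Finset σ} {j : σ} (hj : j ∈ S) (b' c : σ → K)
    (hb'j : b' j = 0) (hb' : ∀ i, i ∉ S → b' i = 0) (hc : ∀ i ∈ S, c i = 0) (s : CState σ K)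
    (hclean : deletePthPowers p s.F = s.F) (hF : s.F ≠ 0) (hr : ∀ d ∈ s.F.support, s.r ≤ d)
    (hq : ∀ d ∈ s.F.support, p ≤ degIn S d)
    (hpermc : ((degIn S (s.r.filter (fun i => c i = 0)) : ℕ) : ℕ∞) +
        CState.shade ⟨deletePthPowers p (PointBlowup.translate c s.F),
          s.r.filter (fun i => c i = 0), s.exc.filter (fun i => c i = 0)⟩ ≤
      ordAlong S (deletePthPowers p (PointBlowup.translate c s.F))) :
    (step p S j (b' + c) s).shade ≤
      CState.shade ⟨deletePthPowers p (PointBlowup.translate c s.F),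
        s.r.filter (fun i => c i = 0), s.exc.filter (fun i => c i = 0)⟩ + 1 := by
  set M : CState σ K := ⟨deletePthPowers p (PointBlowup.translate c s.F),
    s.r.filter (fun i => c i = 0), s.exc.filter (fun i => c i = 0)⟩ with hM
  rw [step_add_eq_step_translate_clean_one p hj b' c hb' hc s hclean]
  have hMF : M.F ≠ 0 := clean_translate_ne_zero p c hclean hF
  obtain ⟨oM, hoM⟩ := exists_ordZero_eq_natCast hMF
  have hcleanM : deletePthPowers p M.F = M.F := PointBlowup.deletePthPowers_deletePthPowers p _
  have hrM : ∀ e ∈ M.F.support, M.r ≤ e := fun e he =>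
    filter_le_of_mem_support_clean_translate p c hr he
  have hqM : ∀ e ∈ M.F.support, p ≤ degIn S e := fun e he =>
    le_degIn_of_mem_support_clean_translate p c hc hq he
  have hpermM : ∀ e ∈ M.F.support, degIn S M.r + (oM - M.r.degree) ≤ degIn S e := by
    intro e he
    have h1 : ((degIn S M.r : ℕ) : ℕ∞) + M.shade ≤ (degIn S e : ℕ∞) :=
      le_trans hpermc (ordAlong_le_of_mem_support he)
    rw [CState.shade_eq_of_ordZero_eq M hoM, ← Nat.cast_add] at h1
    exact_mod_cast h1
  exact mohBound_one p hj b' hb'j hb' M hcleanM hoM hrM hqM hpermM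

/-- **Moh's `+1` relative to the shade AT THE ORIGIN, when the shade does not jump at `c`.** If
`C_S` is Moh/HP-permissible for `s` at the origin ((1): `p ≤ degIn S d`; (2):
`degIn S r + shade(s) ≤ ord_{C_S} F`) and the moved state has the SAME shade, `shade(s@c) = shade(s)`,
then (2) holds at `c` as well and `shade(step p S j (b' + c) s) ≤ shade(s) + 1`. Without the no-jump
clause only `shade(s@c) ≥ shade(s)` holds (`shade_le_shade_translate`) and (2) may fail at `c`.
[cite: Moh1987, Stability Theorem (one permissible blow-up), §1] -/
theorem shade_step_le_shade_add_one_of_shade_translate_eq {S : Finset σ} {j : σ} (hj : j ∈ S)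
    (b' c : σ → K) (hb'j : b' j = 0) (hb' : ∀ i, i ∉ S → b' i = 0) (hc : ∀ i ∈ S, c i = 0)
    (s : CState σ K) (hclean : deletePthPowers p s.F = s.F) (hF : s.F ≠ 0)
    (hr : ∀ d ∈ s.F.support, s.r ≤ d) (hq : ∀ d ∈ s.F.support, p ≤ degIn S d)
    (hperm : ((degIn S s.r : ℕ) : ℕ∞) + s.shade ≤ ordAlong S s.F)
    (heq : CState.shade ⟨deletePthPowers p (PointBlowup.translate c s.F),
        s.r.filter (fun i => c i = 0), s.exc.filter (fun i => c i = 0)⟩ = s.shade) :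
    (step p S j (b' + c) s).shade ≤ s.shade + 1 := by
  have h := shade_step_le_shade_translate_add_one p hj b' c hb'j hb' hc s hclean hF hr hq (by
    rw [heq, degIn_filter_eq c hc, ordAlong_deletePthPowers_translate p c hc hclean]
    exact hperm)
  rwa [heq] at h

omit [Fintype σ] [DecidableEq σ] hp [CharP K p] [DecidableEq K] in
/-- The cell's `Perm2`-form of condition (2) at the origin is the tree's monomialwise form.
[folklore] -/
theorem perm_of_shade_le_ordAlong {S : Finset σ} (s : CState σ K) {o : ℕ} (ho : ordZero s.F = o)
    (hperm : ((degIn S s.r : ℕ) : ℕ∞) + s.shade ≤ ordAlong S s.F) :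
    ∀ d ∈ s.F.support, degIn S s.r + (o - s.r.degree) ≤ degIn S d := by
  intro d hd
  have h1 := le_trans hperm (ordAlong_le_of_mem_support hd)
  rw [CState.shade_eq_of_ordZero_eq s ho, ← Nat.cast_add] at h1
  exact_mod_cast h1

omit hp [CharP K p] in
/-- **(iii)⁺ in `Perm2`-form**: under (2) at the origin, `shade(s) ≤ shade(s@c)` at every point `c`
of the centre. [folklore] -/
theorem shade_le_shade_translate_of_perm (q : ℕ) {S : Finset σ} (c : σ → K)
    (hc : ∀ i ∈ S, c i = 0) (s : CState σ K) (hF : s.F ≠ 0) (hr : ∀ d ∈ s.F.support, s.r ≤ d)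
    (hperm : ((degIn S s.r : ℕ) : ℕ∞) + s.shade ≤ ordAlong S s.F) :
    s.shade ≤ CState.shade ⟨deletePthPowers q (PointBlowup.translate c s.F),
      s.r.filter (fun i => c i = 0), s.exc.filter (fun i => c i = 0)⟩ := by
  obtain ⟨o, ho⟩ := exists_ordZero_eq_natCast hF
  exact shade_le_shade_translate q c hc s ho hr (perm_of_shade_le_ordAlong s ho hperm)

end Bound

/-! ## 3. The cell's frame: `PIDim4.State`, `IsPermissibleCentre`, `Perm2`, `Edge` -/

section Frame

variable {K : Type} [Field K] [DecidableEq K] (p : ℕ) [hp : Fact p.Prime] [CharP K p]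

omit [DecidableEq K] hp [CharP K p] in
/-- The decomposition of a point `b` of the chart into its fibre part `S.piecewise b 0` (supported
in `S`) and its centre part `S.piecewise 0 b` (supported off `S`). [folklore] -/
theorem piecewise_add_piecewise (S : Finset (Fin 4)) (b : Fin 4 → K) :
    S.piecewise b (0 : Fin 4 → K) + S.piecewise (0 : Fin 4 → K) b = b := by
  funext i
  rw [Pi.add_apply, Finset.piecewise, Finset.piecewise]
  split_ifs
  · rw [Pi.zero_apply, add_zero]
  · rw [Pi.zero_apply, zero_add]

/-- **Referee form for an arbitrary chart point** (class `(4,1)`, order of record `p`): for a clean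
presented state `s` (`F ≠ 0`, `x^r ∣ F`), a Hironaka-permissible `S ∋ j` and ANY `b` with `b_j = 0`,
if condition (2) holds for the state moved to the centre part `c = S.piecewise 0 b` of `b`, then
`shade(step p S j b s) ≤ shade(s@c) + 1`. [cite: Moh1987, Stability Theorem (one permissible blow-up), §1] -/
theorem shade_step_le_shade_translate_add_one_piecewise {S : Finset (Fin 4)} {j : Fin 4} (hj : j ∈ S)
    (b : Fin 4 → K) (hbj : b j = 0) (s : State K) (hperm1 : IsPermissibleCentre p S s.F)
    (hclean : deletePthPowers p s.F = s.F) (hF : s.F ≠ 0) (hr : ∀ d ∈ s.F.support, s.r ≤ d)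
    (hpermc : ((degIn S (s.r.filter (fun i => S.piecewise (0 : Fin 4 → K) b i = 0)) : ℕ) : ℕ∞) +
        CState.shade ⟨deletePthPowers p (PointBlowup.translate (S.piecewise (0 : Fin 4 → K) b) s.F),
          s.r.filter (fun i => S.piecewise (0 : Fin 4 → K) b i = 0),
          s.exc.filter (fun i => S.piecewise (0 : Fin 4 → K) b i = 0)⟩ ≤
      ordAlong S (deletePthPowers p (PointBlowup.translate (S.piecewise (0 : Fin 4 → K) b) s.F))) :
    (step p S j b s).shade ≤
      CState.shade ⟨deletePthPowers p (PointBlowup.translate (S.piecewise (0 : Fin 4 → K) b) s.F),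
        s.r.filter (fun i => S.piecewise (0 : Fin 4 → K) b i = 0),
        s.exc.filter (fun i => S.piecewise (0 : Fin 4 → K) b i = 0)⟩ + 1 := by
  have hq : ∀ d ∈ s.F.support, p ≤ degIn S d := fun d hd => by
    have := le_trans hperm1.2 (ordAlong_le_of_mem_support hd)
    exact_mod_cast this
  have h := shade_step_le_shade_translate_add_one p hj (S.piecewise b (0 : Fin 4 → K))
    (S.piecewise (0 : Fin 4 → K) b) (by rw [Finset.piecewise, if_pos hj, hbj])
    (fun i hi => by rw [Finset.piecewise, if_neg hi, Pi.zero_apply])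
    (fun i hi => by rw [Finset.piecewise, if_pos hi, Pi.zero_apply]) s hclean hF hr hq hpermc
  rwa [piecewise_add_piecewise] at h

/-- **Moh's `+1` on every edge along a centre on which the shade is constant.** Class `(4,1)`, order
of record `p`: let `s` be a clean presented state (`F ≠ 0`, `x^r ∣ F`) and `S` a coordinate centre
satisfying (1) `IsPermissibleCentre p S s.F` and (2) `Perm2 S s` at the origin, such that the shade of
the state moved to any `K`-point `c` of the centre equals `shade(s)` (no special point among the
`K`-points). Then along every `Edge p S s s'` (any chart `j ∈ S`, any point `b`, `b_j = 0`):
`s'.shade ≤ s.shade + 1` — the RISE:d flag of such an edge is at most `+1`. The constancy clause cannot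
be dropped (`PurelyInseparableDim4MohAlongSpecialPoint.lean`). [cite: Moh1987, Stability Theorem (one
permissible blow-up), §1] [cite: HauserPerlega2019PRIMS, §3 Theorem (9)] -/
theorem shade_le_add_one_of_edge {S : Finset (Fin 4)} (s s' : State K)
    (hperm1 : IsPermissibleCentre p S s.F) (hperm2 : Perm2 S s)
    (hclean : deletePthPowers p s.F = s.F) (hr : ∀ d ∈ s.F.support, s.r ≤ d)
    (hconst : ∀ c : Fin 4 → K, (∀ i ∈ S, c i = 0) →
      CState.shade ⟨deletePthPowers p (PointBlowup.translate c s.F),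
        s.r.filter (fun i => c i = 0), s.exc.filter (fun i => c i = 0)⟩ = s.shade)
    (hedge : Edge p S s s') : s'.shade ≤ s.shade + 1 := by
  obtain ⟨j, b, hj, hbj, -, hne, rfl⟩ := hedge
  have hF : s.F ≠ 0 := by
    intro h0
    apply hne
    -- a zero residual polynomial has zero chart transform, translate and cleaning
    show deletePthPowers p (PointBlowup.translate b (chartTransform p S j s.F)) = 0
    rw [h0, chartTransform_zero]
    unfold PointBlowup.translate
    rw [map_zero, deletePthPowers_zero]
  have hq : ∀ d ∈ s.F.support, p ≤ degIn S d := fun d hd => by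
    have := le_trans hperm1.2 (ordAlong_le_of_mem_support hd)
    exact_mod_cast this
  have hc0 : ∀ i ∈ S, S.piecewise (0 : Fin 4 → K) b i = 0 := fun i hi => by
    rw [Finset.piecewise, if_pos hi, Pi.zero_apply]
  have h := shade_step_le_shade_add_one_of_shade_translate_eq p hj (S.piecewise b (0 : Fin 4 → K))
    (S.piecewise (0 : Fin 4 → K) b) (by rw [Finset.piecewise, if_pos hj, hbj])
    (fun i hi => by rw [Finset.piecewise, if_neg hi, Pi.zero_apply]) hc0 s hclean hF hr hq hperm2
    (hconst _ hc0)
  rwa [piecewise_add_piecewise] at h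

end Frame

end MohAlong

end Summit.ResolutionOfSingularities.ResolutionOfSingularities.Theorems.PIDim4

end
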